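import Mathlib
import HarnessLib
import Summits.NavierStokesRegularity.NavierStokesRegularity.Theorems.UnthreadedRigidityDoorUnthreadedRigidityThreadingJetsVirialFields
import Summits.NavierStokesRegularity.NavierStokesRegularity.Theorems.UnthreadedRigidityDoorUnthreadedRigidityThreadingJetsVirialWeights

/-!
# THREADING JETS, VIRIAL RAMPS: the ramp estimate and the decay / continuity moduli for the VIRIAL LEMMA

Helpers for `virialLemmaSlice_holds` (file `…ThreadingJetsVirialLemma`): the growth bound `|A₂(y)| ≤ M₂|y|^{4l−4}` of the bracket
`A₂ = {Y, A}`, the weight algebra `(|y|²)^{1−m}|y|^{4l−4} = |y|⁻¹` for `m = (4l−1)/2`, the RAMP ESTIMATE `ramp_integral_le`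
(`|∫ w · 2φ(|y|²)(|y|²)^{1−m} · A₂| ≤ 16·vol(B̄₁)·C·M₂·η` when `φ` lives on `(ρ², 2ρ²)` with `|φ| ≤ C/ρ²` and `|w| ≤ η` on the shell
`ρ ≤ |y| ≤ 2ρ` — the bound is SCALE-FREE in `ρ`), and the two moduli of a continuous function decaying at infinity.
W2 ⟨stmt-27585⟩ support, line g11-1 (VIRIAL HORN), director split dss_146 (1) half (B′).
-/

noncomputable section

-- the summit and its single sub-problem share the name (CONVENTIONS §1), as in every Theorems file
set_option linter.dupNamespace false

namespace Summit.NavierStokesRegularity.NavierStokesRegularity.Theorems.UnthreadedRigidity.ThreadingJets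

open Set Function Filter Topology MeasureTheory Metric
open scoped RealInnerProductSpace InnerProductSpace ContDiff
open Literature.Analysis.FluidPDE
open Summit.NavierStokesRegularity.NavierStokesRegularity.Theorems.UnthreadedRigidity.ProfileHorn (E3)
open Summit.NavierStokesRegularity.NavierStokesRegularity.Theorems.UnthreadedRigidity.VirialHorn
  (IsSolidHarmonic VirialAdmissible sepShellL virialMoment angForm pbr det3 strainAmpL)

variable {l : ℕ} {Y : E3 → ℝ}

/-! ### 1. Growth of the bracket `A₂` and the weight algebra -/

/-- `|A₂(y)| ≤ M₂ |y|^{4l−4}` (homogeneity of degree `4l−4` and compactness of the unit sphere). [folklore] -/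
theorem exists_bound_pbr_angForm (hY : IsSolidHarmonic l Y) (hl : 1 ≤ l) :
    ∃ M₂ : ℝ, 0 ≤ M₂ ∧ ∀ y : E3, |pbr Y (angForm Y) y| ≤ M₂ * ‖y‖ ^ (4 * l - 4) := by
  have hc : Continuous (pbr Y (angForm Y)) := (contDiff_pbr_angForm hY).continuous
  obtain ⟨M, hM⟩ := (isCompact_sphere (0 : E3) 1).exists_bound_of_continuousOn hc.continuousOn
  refine ⟨max M 0, le_max_right _ _, fun y => ?_⟩
  by_cases hy : y = 0
  · subst hy
    have : pbr Y (angForm Y) 0 = 0 := by simp [pbr, det3]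
    rw [this, abs_zero]
    positivity
  have hn : 0 < ‖y‖ := norm_pos_iff.2 hy
  set u : E3 := ‖y‖⁻¹ • y with hu_def
  have hu : u ∈ sphere (0 : E3) 1 := by
    rw [mem_sphere_zero_iff_norm, hu_def, norm_smul, Real.norm_of_nonneg (inv_nonneg.2 hn.le), inv_mul_cancel₀ hn.ne']
  have hyu : y = ‖y‖ • u := by rw [hu_def, smul_smul, mul_inv_cancel₀ hn.ne', one_smul]
  have hcast : ((4 * l : ℤ) - 4) = ((4 * l - 4 : ℕ) : ℤ) := by omega
  have h1 : pbr Y (angForm Y) y = ‖y‖ ^ (4 * l - 4) * pbr Y (angForm Y) u := by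
    conv_lhs => rw [hyu]
    rw [pbr_angForm_smul hY hn, smul_eq_mul, hcast, zpow_natCast]
  rw [h1, abs_mul, abs_of_nonneg (by positivity), mul_comm]
  have h2 : |pbr Y (angForm Y) u| ≤ max M 0 := (by simpa [Real.norm_eq_abs] using hM u hu : |pbr Y (angForm Y) u| ≤ M).trans (le_max_left _ _)
  exact mul_le_mul_of_nonneg_right h2 (by positivity)

/-- The weight algebra: `(|y|²)^{1−m} |y|^{4l−4} = |y|⁻¹` for `m = (4l−1)/2` and `y ≠ 0`. [folklore] -/
theorem rpow_weight_mul_pow (hl : 1 ≤ l) {y : E3} (hy : y ≠ 0) :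
    (‖y‖ ^ 2) ^ (1 - ((4 * (l : ℝ) - 1) / 2)) * ‖y‖ ^ (4 * l - 4) = ‖y‖⁻¹ := by
  have hn : 0 < ‖y‖ := norm_pos_iff.2 hy
  have hcast : ((4 * l - 4 : ℕ) : ℝ) = 4 * (l : ℝ) - 4 := by
    rw [Nat.cast_sub (by omega)]; push_cast; ring
  rw [← Real.rpow_natCast ‖y‖ 2, ← Real.rpow_mul hn.le, ← Real.rpow_natCast ‖y‖ (4 * l - 4), hcast,
    ← Real.rpow_add hn, ← Real.rpow_neg_one]
  congr 1
  push_cast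
  ring

/-- The weight is comparable on both sides: `(|y|²)^{−m}` as the reciprocal `m`-th power. For `0 < s ≤ s₁`: `s₁^{−m} ≤ s^{−m}` (`m ≥ 0`). [folklore] -/
theorem rpow_neg_antitone {m s s₁ : ℝ} (hm : 0 ≤ m) (hs : 0 < s) (hle : s ≤ s₁) : s₁ ^ (-m) ≤ s ^ (-m) := by
  rw [Real.rpow_neg (hs.le.trans hle), Real.rpow_neg hs.le]
  exact inv_anti₀ (Real.rpow_pos_of_pos hs _) (Real.rpow_le_rpow hs.le hle hm)

/-! ### 2. The ramp estimate -/

/-- **THE RAMP ESTIMATE.**  Let `φ` (a ramp derivative) satisfy `|φ| ≤ C/ρ²` and vanish off `(ρ², 2ρ²)`, let `|w| ≤ η` on the shell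
`ρ ≤ |y| ≤ 2ρ`, and `|A₂(y)| ≤ M₂|y|^{4l−4}`.  Then `|∫ w · (2 φ(|y|²) (|y|²)^{1−m}) · A₂| ≤ 16 · vol(B̄₁) · C · M₂ · η` — INDEPENDENT of `ρ`
(the shell has volume `∼ρ³`, the weight is `∼ρ⁻¹`, the ramp derivative `∼ρ⁻²`). [folklore] -/
theorem ramp_integral_le (hl : 1 ≤ l) {M₂ : ℝ} (hM₂ : 0 ≤ M₂) (hA₂ : ∀ y : E3, |pbr Y (angForm Y) y| ≤ M₂ * ‖y‖ ^ (4 * l - 4))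
    {ρ C η : ℝ} (hρ : 0 < ρ) (hC : 0 ≤ C) (hη : 0 ≤ η) {φ : ℝ → ℝ} (hφC : ∀ s, |φ s| ≤ C / ρ ^ 2)
    (hφ0 : ∀ s, s ∉ Ioo (ρ ^ 2) (2 * ρ ^ 2) → φ s = 0) {w : E3 → ℝ}
    (hw : ∀ y : E3, ρ ≤ ‖y‖ → ‖y‖ ≤ 2 * ρ → |w y| ≤ η) :
    |∫ y : E3, w y * ((2 * φ (‖y‖ ^ 2) * (‖y‖ ^ 2) ^ (1 - ((4 * (l : ℝ) - 1) / 2))) * pbr Y (angForm Y) y)| ≤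
      16 * (volume : Measure E3).real (closedBall (0 : E3) 1) * C * M₂ * η := by
  set K : ℝ := η * (2 * (C / ρ ^ 2) * (M₂ * ρ⁻¹)) with hK_def
  have hK0 : 0 ≤ K := by positivity
  -- pointwise majorant
  have hpt : ∀ y : E3, ‖w y * ((2 * φ (‖y‖ ^ 2) * (‖y‖ ^ 2) ^ (1 - ((4 * (l : ℝ) - 1) / 2))) * pbr Y (angForm Y) y)‖ ≤
      (closedBall (0 : E3) (2 * ρ)).indicator (fun _ => K) y := by
    intro y
    by_cases hs : ‖y‖ ^ 2 ∈ Ioo (ρ ^ 2) (2 * ρ ^ 2)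
    · have hρy : ρ < ‖y‖ := (pow_lt_pow_iff_left₀ hρ.le (norm_nonneg y) two_ne_zero).1 hs.1
      have hy2 : ‖y‖ < 2 * ρ := by
        have h4 : ‖y‖ ^ 2 < (2 * ρ) ^ 2 := by nlinarith [hs.2]
        exact (pow_lt_pow_iff_left₀ (norm_nonneg y) (by positivity) two_ne_zero).1 h4
      have hy0 : y ≠ 0 := norm_pos_iff.1 (hρ.trans hρy)
      rw [Set.indicator_of_mem (by rw [mem_closedBall_zero_iff]; exact hy2.le), Real.norm_eq_abs]
      have hse : 0 ≤ (‖y‖ ^ 2) ^ (1 - ((4 * (l : ℝ) - 1) / 2)) := Real.rpow_nonneg (by positivity) _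
      have hw1 := hw y hρy.le hy2.le
      have hφ1 := hφC (‖y‖ ^ 2)
      have hA1 := hA₂ y
      calc |w y * ((2 * φ (‖y‖ ^ 2) * (‖y‖ ^ 2) ^ (1 - ((4 * (l : ℝ) - 1) / 2))) * pbr Y (angForm Y) y)|
          = |w y| * ((2 * |φ (‖y‖ ^ 2)| * (‖y‖ ^ 2) ^ (1 - ((4 * (l : ℝ) - 1) / 2))) * |pbr Y (angForm Y) y|) := by
            rw [abs_mul, abs_mul, abs_mul, abs_mul, abs_of_nonneg hse, abs_two]
        _ ≤ η * ((2 * (C / ρ ^ 2) * (‖y‖ ^ 2) ^ (1 - ((4 * (l : ℝ) - 1) / 2))) * (M₂ * ‖y‖ ^ (4 * l - 4))) := by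
            gcongr
        _ = η * (2 * (C / ρ ^ 2)) * M₂ * ((‖y‖ ^ 2) ^ (1 - ((4 * (l : ℝ) - 1) / 2)) * ‖y‖ ^ (4 * l - 4)) := by ring
        _ = η * (2 * (C / ρ ^ 2)) * M₂ * ‖y‖⁻¹ := by rw [rpow_weight_mul_pow hl hy0]
        _ ≤ η * (2 * (C / ρ ^ 2)) * M₂ * ρ⁻¹ := by
            have hinv : ‖y‖⁻¹ ≤ ρ⁻¹ := inv_anti₀ hρ hρy.le
            gcongr
        _ = K := by rw [hK_def]; ring
    · rw [hφ0 _ hs]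
      simp only [mul_zero, zero_mul, norm_zero]
      exact Set.indicator_nonneg (fun _ _ => hK0) y
  have hint : Integrable ((closedBall (0 : E3) (2 * ρ)).indicator fun _ => K) (volume : Measure E3) :=
    ((continuousOn_const).integrableOn_compact (isCompact_closedBall (0 : E3) (2 * ρ))).integrable_indicator
      measurableSet_closedBall
  have h1 := norm_integral_le_of_norm_le hint (Eventually.of_forall hpt)
  rw [Real.norm_eq_abs, integral_indicator_const K measurableSet_closedBall, smul_eq_mul,
    Measure.addHaar_real_closedBall' volume (0 : E3) (by positivity : (0 : ℝ) ≤ 2 * ρ), finrank_euclideanSpace_fin] at h1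
  refine h1.trans (le_of_eq ?_)
  rw [hK_def]
  field_simp
  ring


/-! ### 3. Decay and continuity moduli of the pressure slice -/

/-- A function tending to `0` at infinity is `η`-small outside a large ball. [folklore] -/
theorem exists_radius_of_tendsto_cocompact {q : E3 → ℝ} (hq0 : Tendsto q (cocompact E3) (𝓝 0)) {η : ℝ} (hη : 0 < η) :
    ∃ R : ℝ, 0 < R ∧ ∀ y : E3, R ≤ ‖y‖ → |q y| ≤ η := by
  have hev : ∀ᶠ y in cocompact E3, |q y| < η := by
    have h := hq0 (Metric.ball_mem_nhds (0 : ℝ) hη)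
    filter_upwards [h] with y hy
    simpa [Real.dist_eq] using hy
  rw [← Metric.cobounded_eq_cocompact] at hev
  obtain ⟨R, -, hR⟩ := (Metric.hasBasis_cobounded_compl_closedBall (0 : E3)).mem_iff.1 hev
  refine ⟨max R 0 + 1, by positivity, fun y hy => le_of_lt (hR ?_)⟩
  rw [mem_compl_iff, mem_closedBall_zero_iff, not_le]
  linarith [le_max_left R 0]

/-- A continuous function is `η`-close to its value at the origin on a small ball. [folklore] -/
theorem exists_radius_of_continuous {q : E3 → ℝ} (hqc : Continuous q) {η : ℝ} (hη : 0 < η) :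
    ∃ δ : ℝ, 0 < δ ∧ ∀ y : E3, ‖y‖ ≤ δ → |q y - q 0| ≤ η := by
  have h := Metric.continuousAt_iff.1 (hqc.continuousAt (x := (0 : E3))) η hη
  obtain ⟨δ, hδ, hδ'⟩ := h
  refine ⟨δ / 2, by positivity, fun y hy => le_of_lt ?_⟩
  have : dist y 0 < δ := by rw [dist_zero_right]; linarith
  simpa [Real.dist_eq] using hδ' this

end Summit.NavierStokesRegularity.NavierStokesRegularity.Theorems.UnthreadedRigidity.ThreadingJets

end
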